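import Summits.AtomisticToContinuum.HydrodynamicLimit.Theorems.RelayRaceLocalityNearConstantShortTimeHLMeansPinDefs
import Summits.AtomisticToContinuum.HydrodynamicLimit.Theorems.RelayRaceLocalityNearConstantShortTimeHLMeansPinStatics
import Summits.AtomisticToContinuum.HydrodynamicLimit.Theorems.RelayRaceLocalityNearConstantShortTimeHLMeansPinEntropy
import Summits.AtomisticToContinuum.HydrodynamicLimit.Theorems.DenseExcursion.Negative.Everywhere
import Summits.AtomisticToContinuum.HydrodynamicLimit.Theorems.RelayRaceLocalityNearConstantShortTimeHLHLDefs
import HarnessLib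

/-!
# Crux `NearConstantShortTimeHL` (stmt-AtomisticToContinuum-12502), line `small-tilt-domination` — stub `stub_meansPinHL`

Support file (`--supports stmt-AtomisticToContinuum-12502`) proving the registered stub

  `stub_meansPinHL : GeneralFamilyLDA → GeneralFamilyConcentration → OneMeanLowerBoundHL → RelEntropyHL`

of the line `small-tilt-domination` (cycle 2, the "HL project": the sub-problem `HydrodynamicLimit` from the three
true-law conjectures; typed statements `OneMeanLowerBoundHL` / `RelEntropyHL` in `…NearConstantShortTimeHLHLDefs.lean`,
S1 `GeneralFamilyLDA` and S2 `GeneralFamilyConcentration` in `…NearConstantShortTimeHLMeansPinDefs.lean`). It is the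
means-pin `stub_meansPin : GeneralFamilyLDA → GeneralFamilyConcentration → OneMeanLowerBound → NearConstantRelEntropy`
(`…NearConstantShortTimeHLMeansPin.lean`) RE-FRAMED for the sub-problem: the prefix is
`∃ η₀ > 0 ∀ (a₀ θ₀ u₀ continuous, positive) ∃ σ₀ > 0 ∀ σ ∈ (0, σ₀) ∀ general families ∀ (T ρ θ u)` classical hs-Euler
solutions `∀ Φ`, canonical local Gibbs laws `P_N` probability measures tied to the Euler data by the LLN at `t = 0`,
`∀ t ∈ [0, T)` under the PACKING guard `ρ σ³ < η₀` on `[0, t]` ONLY — no `M`, no `(δ₀, τ₀)`, no near-constancy. The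
proof is Yau's relative-entropy bookkeeping at the Euler-MATCHED local Gibbs reference, verbatim the proof of
`stub_meansPin` with the frame changed (the engine slot S3 is now `OneMeanLowerBoundHL`, whose guard is the packing
band alone):

1. Thresholds: `η₀ = min(η₁^{S1}, η₁^{S2}, η₀^{S3}, η^{EOS})` (`hsEosLowDensity_proof`: `f_ex` is smooth on `(0, η^{EOS})`),
   `σ₀ = min(σ₀^{S3}, 1, η_A/Λ², η₁^{S2}/(2Λ²))` with `Λ⁻¹ ≤ a₀ ≤ Λ`.
2. At `t = 0` the activity is inverted, `a₀ = e^c ρ^{st} e^{g_σ(ρ^{st})}` with `ρ^{st}` CONTINUOUS of unit mass in the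
   band (`activity_inversion_continuous`); the constant `e^c` drops out of the canonical law, so the laws `P_N`
   ARE the matched laws of `(ρ^{st}, u₀, θ₀)`; S2 (exponential concentration, `n_N → ∞`) and the `t = 0` tie
   (`Φ₀ = id` a.s.) are two laws of large numbers for the same observables under the same probability laws, so
   `(ρ^{st}, u₀, θ₀) = (ρ, u, θ)(0)` (`profiles_eq_of_tendsto`).
3. At `t`: `∫ρ_t = ∫ρ_0 = 1` (mass conservation), the guard gives the band, the reference `Q_N` is the matched
   canonical law of `(ρ_t, u_t, θ_t)` (finite: zero or probability), S2 gives its concentration clause verbatim, and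
   `tendsto_klDiv_div_of_means` — fed by S1 at `0` and at `t` (pressures and the static mean), S3 (the one-sided lower
   bound for the mean of `Λ_t ∘ Φ_t`), and the identity `m₀ − π₀ = m_t − π_t` (mass conservation
   `DenseExcursionEverywhere.integral_density_eq` + isentropy `integral_entropy_eq_of_band_Icc`, using
   `g_σ(r) − rσ³ f_ex′(rσ³) = f_ex(rσ³)` and `log(2πθ) = log 2π + log θ`) — gives `KL((Φ_N t)_* P_N ‖ Q_N)/n_N → 0`.

References: H.-T. Yau, Lett. Math. Phys. 22 (1991) §2; S. Olla – S.R.S. Varadhan – H.-T. Yau, Comm. Math. Phys. 155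
(1993) §3. Not here: S1, S2 (wave-1 statics stubs), S3 (`stub_reductionHL`) and the last step `stub_entropyToLLNHL`.
-/

noncomputable section

namespace Summit.AtomisticToContinuum.HydrodynamicLimit.Theorems.NearConstantShortTimeHL

open MeasureTheory InformationTheory Set Filter Topology
open scoped ENNReal
open Literature.MathematicalPhysics.KineticTheory Literature.Analysis.FluidPDE Literature.Analysis.FunctionSpaces

/-- **THE PIN IN THE SUB-PROBLEM FRAME** (registered stub `stub_meansPinHL` of line `small-tilt-domination`): Yau's
relative-entropy bookkeeping at the Euler-MATCHED local Gibbs reference, general `(ε_N, n_N)` families, general smooth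
pre-shock data (packing guard only, all `t < T`). Thresholds: `η₀ = min(η₁^{S1}, η₁^{S2}, η₀^{S3}, η^{EOS})`,
`σ₀ = min(σ₀^{S3}, inversion/band threshold of a₀)`. At `t = 0` the activity is inverted,
`a₀ = e^c ρ^{st} e^{g_σ(ρ^{st})}` with `ρ^{st}` CONTINUOUS of unit mass (`activity_inversion_continuous`), the constant
drops out of the canonical law (`KineticWindowGronwallNegative.canonicalDensity_const_mul`), and S2 + the tie identify
`(ρ^{st}, u₀, θ₀) = (ρ, u, θ)(0)` (`profiles_eq_of_tendsto`); at `t` the reference is the matched canonical law of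
`(ρ_t, u_t, θ_t)` (finite: zero or probability), S2 gives its exponential concentration, and
`tendsto_klDiv_div_of_means` — fed by S1 at `0` and `t`, S3 (`OneMeanLowerBoundHL`), mass conservation and isentropy
(`integral_entropy_eq_of_band_Icc`) — gives `KL((Φ_N t)_* P_N ‖ Q_N)/n_N → 0`. [cite: Yau1991, §2] -/
theorem stub_meansPinHL :
    GeneralFamilyLDA → GeneralFamilyConcentration → OneMeanLowerBoundHL → RelEntropyHL := by
  intro hS1 hS2 hS3
  obtain ⟨η₁, hη₁, H1⟩ := hS1
  obtain ⟨η₂, hη₂, H2⟩ := hS2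
  obtain ⟨η₃, hη₃, H3⟩ := hS3
  obtain ⟨ηE, hηE, F, hFa, hEqF, hF0, -, -⟩ := hsEosLowDensity_proof
  obtain ⟨ηA, hηA, hinvA⟩ := activity_inversion_continuous hηE hFa hEqF hF0
  -- the excess free energy is smooth on the open band `(0, ηE)`
  have hfex : ContDiffOn ℝ ((⊤ : ℕ∞) : WithTop ℕ∞) hsExcessFreeEnergy (Ioo 0 ηE) :=
    (hFa.contDiffOn_of_completeSpace.mono (Ioo_subset_Ioo (by linarith) le_rfl)).congr
      fun r hr => hEqF ⟨hr.1.le, hr.2⟩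
  -- the packing threshold
  set η₀ : ℝ := min (min η₁ η₂) (min η₃ ηE) with hη₀def
  have hη₀ : 0 < η₀ := lt_min (lt_min hη₁ hη₂) (lt_min hη₃ hηE)
  have hη₀₁ : η₀ ≤ η₁ := (min_le_left _ _).trans (min_le_left _ _)
  have hη₀₂ : η₀ ≤ η₂ := (min_le_left _ _).trans (min_le_right _ _)
  have hη₀₃ : η₀ ≤ η₃ := (min_le_right _ _).trans (min_le_left _ _)
  have hη₀E : η₀ ≤ ηE := (min_le_right _ _).trans (min_le_right _ _)
  refine ⟨η₀, hη₀, fun a₀ θ₀ u₀ ha hθ hu ha0 hθ0 => ?_⟩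
  obtain ⟨σ₃, hσ₃, H3P⟩ := H3 a₀ θ₀ u₀ ha hθ hu ha0 hθ0
  -- bounds on the activity profile
  obtain ⟨Aup, -, hAup⟩ := exists_forall_abs_le_of_continuous ha
  obtain ⟨x₀, -, hx₀⟩ := isCompact_univ.exists_isMinOn univ_nonempty ha.continuousOn
  have hamin : ∀ x, a₀ x₀ ≤ a₀ x := fun x => hx₀ (mem_univ x)
  set Λ : ℝ := max (max Aup (a₀ x₀)⁻¹) 1 with hΛdef
  have hΛ1 : 1 ≤ Λ := le_max_right _ _
  have hΛ0 : 0 < Λ := one_pos.trans_le hΛ1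
  have haΛ : ∀ x, Λ⁻¹ ≤ a₀ x ∧ a₀ x ≤ Λ := by
    intro x
    constructor
    · have h1 : (a₀ x₀)⁻¹ ≤ Λ := (le_max_right _ _).trans (le_max_left _ _)
      calc Λ⁻¹ ≤ ((a₀ x₀)⁻¹)⁻¹ := inv_anti₀ (inv_pos.2 (ha0 x₀)) h1
        _ = a₀ x₀ := inv_inv _
        _ ≤ a₀ x := hamin x
    · exact ((le_abs_self _).trans (hAup x)).trans ((le_max_left _ _).trans (le_max_left _ _))
  -- the threshold in `σ`
  set σA : ℝ := min 1 (min (ηA / Λ ^ 2) (η₂ / (2 * Λ ^ 2))) with hσAdef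
  have hσA : 0 < σA := lt_min one_pos (lt_min (by positivity) (by positivity))
  refine ⟨min σ₃ σA, lt_min hσ₃ hσA, ?_⟩
  intro σ hσ hσlt ε n hε hε0 hn T ρ θ u hE Φ
  dsimp only
  intro hP h0 t ht hg
  have hσ₃' : σ < σ₃ := hσlt.trans_le (min_le_left _ _)
  have hσA' : σ < σA := hσlt.trans_le (min_le_right _ _)
  have hσ1 : σ ≤ 1 := (hσA'.trans_le (min_le_left _ _)).le
  have hσ3 : 0 < σ ^ 3 := pow_pos hσ 3
  have hσ3le : σ ^ 3 ≤ σ := by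
    calc σ ^ 3 = σ * (σ * σ) := by ring
      _ ≤ σ * 1 := by gcongr; nlinarith
      _ = σ := mul_one σ
  have hpack : Λ ^ 2 * σ ^ 3 ≤ ηA := by
    have h1 : σ ≤ ηA / Λ ^ 2 := (hσA'.trans_le ((min_le_right _ _).trans (min_le_left _ _))).le
    rw [le_div_iff₀ (by positivity)] at h1
    nlinarith
  have hband2 : 2 * Λ ^ 2 * σ ^ 3 ≤ η₂ := by
    have h1 : σ ≤ η₂ / (2 * Λ ^ 2) := (hσA'.trans_le ((min_le_right _ _).trans (min_le_right _ _))).le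
    rw [le_div_iff₀ (by positivity)] at h1
    nlinarith
  have hn_top : Tendsto n atTop atTop := tendsto_atTop_of_tendsto_mul_pow_three hσ hε hε0 hn
  have htT : t < T := ht.2
  have h0I : (0 : ℝ) ∈ Ico 0 T := ⟨le_rfl, ht.1.trans_lt htT⟩
  have h0t : (0 : ℝ) ∈ Icc 0 t := ⟨le_rfl, ht.1⟩
  have htt : t ∈ Icc 0 t := ⟨ht.1, le_rfl⟩
  -- the local chemical potential correction `g_σ`
  set g : ℝ → ℝ := fun r => hsExcessFreeEnergy (r * σ ^ 3) + r * σ ^ 3 * deriv hsExcessFreeEnergy (r * σ ^ 3)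
    with hgdef
  ------------------------------------------------------------------
  -- Step 1: inversion of the activity at `t = 0`
  ------------------------------------------------------------------
  obtain ⟨ρst, hρstc, hρstb, hρst1, c, hc⟩ := hinvA σ hσ Λ hΛ1 hpack a₀ ha haΛ
  have hρst0 : ∀ x, 0 < ρst x := fun x => (by positivity : (0 : ℝ) < (2 * Λ ^ 2)⁻¹).trans_le (hρstb x).1
  have ha₀eq : a₀ = fun x => Real.exp c * (ρst x * Real.exp (g (ρst x))) := by
    funext x; rw [hc x]; ring
  subst ha₀eq
  -- the constant drops out: the laws ARE the matched laws of `(ρst, u₀, θ₀)`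
  have hcd : ∀ N, canonicalDensity (Torus.geometry (Fin 3)) (ε N) (n N)
      (localGibbsProfile (fun x => Real.exp c * (ρst x * Real.exp (g (ρst x)))) u₀ θ₀) =
      canonicalDensity (Torus.geometry (Fin 3)) (ε N) (n N)
        (localGibbsProfile (fun x => ρst x * Real.exp (g (ρst x))) u₀ θ₀) := by
    intro N
    funext z
    rw [MacroClosureLine.StubLedger.localGibbsProfile_const_mul]
    exact KineticWindowGronwallNegative.canonicalDensity_const_mul (Real.exp_pos c).ne' _ _ z
  have hPeq : ∀ N, particleLaw (Φ N) (canonicalDensity (Torus.geometry (Fin 3)) (ε N) (n N)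
      (localGibbsProfile (fun x => Real.exp c * (ρst x * Real.exp (g (ρst x)))) u₀ θ₀)) =
      particleLaw (Φ N) (canonicalDensity (Torus.geometry (Fin 3)) (ε N) (n N)
        (localGibbsProfile (fun x => ρst x * Real.exp (g (ρst x))) u₀ θ₀)) := fun N => by rw [hcd N]
  ------------------------------------------------------------------
  -- Step 2: identification of the Euler data at `t = 0`
  ------------------------------------------------------------------
  have hS2₀ := H2 σ hσ (2 * Λ ^ 2)⁻¹ (by positivity) ρst hρstc
    (fun x => ⟨(hρstb x).1, (mul_le_mul_of_nonneg_right (hρstb x).2 hσ3.le).trans hband2⟩) hρst1 u₀ θ₀ hu hθ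
    hθ0 ε n hε hε0 hn
  have hident := profiles_eq_of_tendsto
    (P := fun N => particleLaw (Φ N) (canonicalDensity (Torus.geometry (Fin 3)) (ε N) (n N)
      (localGibbsProfile (fun x => Real.exp c * (ρst x * Real.exp (g (ρst x)))) u₀ θ₀)))
    hP (fun N z χ => empiricalDensityField z χ) (fun N z χ => empiricalMomentumField z χ)
    (fun N z χ => empiricalEnergyField z χ) hρstc hθ hu
    (hE.smooth_density.isSmooth_slice h0I).continuous (hE.smooth_temperature.isSmooth_slice h0I).continuous
    (hE.smooth_velocity.isSmooth_slice h0I).continuous hρst0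
    (fun χ hχ δ hδ => by
      obtain ⟨C, hC, hCN⟩ := hS2₀ χ hχ δ hδ
      refine ⟨tendsto_zero_of_le_exp hn_top hC fun N => ?_, tendsto_zero_of_le_exp hn_top hC fun N => ?_,
        tendsto_zero_of_le_exp hn_top hC fun N => ?_⟩
      · rw [hPeq N]; exact (hCN N).1
      · rw [hPeq N]; exact (hCN N).2.1
      · rw [hPeq N]; exact (hCN N).2.2)
    (fun χ hχ δ hδ => by
      have hac : ∀ N, particleLaw (Φ N) (canonicalDensity (Torus.geometry (Fin 3)) (ε N) (n N)
          (localGibbsProfile (fun x => Real.exp c * (ρst x * Real.exp (g (ρst x)))) u₀ θ₀)) ≪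
          liouville (Torus.geometry (Fin 3)) (n N) (ε N) := fun N => withDensity_absolutelyContinuous _ _
      obtain ⟨h1, h2, h3⟩ := h0 χ hχ δ hδ
      refine ⟨h1.congr fun N => ?_, h2.congr fun N => ?_, h3.congr fun N => ?_⟩
      · exact measure_setOf_flow_zero_mem (Φ N) (hac N) {z | δ < |empiricalDensityField z χ - ∫ x, χ x * ρ 0 x|}
      · exact measure_setOf_flow_zero_mem (Φ N) (hac N)
          {z | δ < ‖empiricalMomentumField z χ - ∫ x, (χ x * ρ 0 x) • u 0 x‖}
      · exact measure_setOf_flow_zero_mem (Φ N) (hac N)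
          {z | δ < |empiricalEnergyField z χ - ∫ x, χ x * totalEnergyDensity (ρ 0 x) (u 0 x) (θ 0 x)|})
  obtain ⟨hρst, hu₀, hθ₀⟩ := hident
  subst hρst hu₀ hθ₀
  ------------------------------------------------------------------
  -- Step 3: the data at time `t`
  ------------------------------------------------------------------
  have hρtc : Continuous (ρ t) := (hE.smooth_density.isSmooth_slice ht).continuous
  have hθtc : Continuous (θ t) := (hE.smooth_temperature.isSmooth_slice ht).continuous
  have hutc : Continuous (u t) := (hE.smooth_velocity.isSmooth_slice ht).continuous
  have hρt0 : ∀ x, 0 < ρ t x := hE.density_pos t ht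
  have hθt0 : ∀ x, 0 < θ t x := hE.temperature_pos t ht
  have hρ00 : ∀ x, 0 < ρ 0 x := hE.density_pos 0 h0I
  have hθ00 : ∀ x, 0 < θ 0 x := hE.temperature_pos 0 h0I
  obtain ⟨xt, -, hxt⟩ := isCompact_univ.exists_isMinOn univ_nonempty hρtc.continuousOn
  have hct : ∀ x, ρ t xt ≤ ρ t x := fun x => hxt (mem_univ x)
  have hmass : ∫ x, ρ t x = 1 := (DenseExcursionEverywhere.integral_density_eq hE ht).trans hρst1
  have hbandt : ∀ x, ρ t xt ≤ ρ t x ∧ ρ t x * σ ^ 3 ≤ η₁ := fun x =>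
    ⟨hct x, ((hg t htt x).le).trans hη₀₁⟩
  have hbandt2 : ∀ x, ρ t xt ≤ ρ t x ∧ ρ t x * σ ^ 3 ≤ η₂ := fun x =>
    ⟨hct x, ((hg t htt x).le).trans hη₀₂⟩
  obtain ⟨x0m, -, hx0m⟩ := isCompact_univ.exists_isMinOn univ_nonempty
    (hE.smooth_density.isSmooth_slice h0I).continuous.continuousOn
  have hc0 : ∀ x, ρ 0 x0m ≤ ρ 0 x := fun x => hx0m (mem_univ x)
  have hband0 : ∀ x, ρ 0 x0m ≤ ρ 0 x ∧ ρ 0 x * σ ^ 3 ≤ η₁ := fun x =>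
    ⟨hc0 x, ((hg 0 h0t x).le).trans hη₀₁⟩
  -- S1 at `0` and `t`, S2 at `t`, S3
  obtain ⟨hπ₀, hm₀i, hm₀⟩ := H1 σ hσ (ρ 0 x0m) (hρ00 x0m) (ρ 0) hρstc hband0 hρst1 (u 0) (θ 0) hu hθ hθ0
    ε n hε hε0 hn
  obtain ⟨hπt, -, -⟩ := H1 σ hσ (ρ t xt) (hρt0 xt) (ρ t) hρtc hbandt hmass (u t) (θ t) hutc hθtc hθt0
    ε n hε hε0 hn
  have hS2t := H2 σ hσ (ρ t xt) (hρt0 xt) (ρ t) hρtc hbandt2 hmass (u t) (θ t) hutc hθtc hθt0 ε n hε hε0 hn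
  have hg3 : ∀ s ∈ Icc 0 t, ∀ x, ρ s x * σ ^ 3 < η₃ := fun s hs x => (hg s hs x).trans_le hη₀₃
  have hS3 := H3P σ hσ hσ₃' ε n hε hε0 hn T ρ θ u hE Φ hP h0 t ht hg3
  ------------------------------------------------------------------
  -- Step 4: the bookkeeping identity `m₀ − π₀ = m_t − π_t` (mass conservation + isentropy)
  ------------------------------------------------------------------
  have hEnt := integral_entropy_eq_of_band_Icc hσ hfex hE ht (fun s hs x => (hg s hs x).trans_le hη₀E)
  have hMass := DenseExcursionEverywhere.integral_density_eq hE ht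
  have hsplit : ∀ s ∈ Icc 0 t,
      (∫ x, ρ s x * (Real.log (ρ s x) + g (ρ s x) - 3 / 2 * Real.log (2 * Real.pi * θ s x) - 3 / 2)) -
        ∫ x, ρ s x * (ρ s x * σ ^ 3 * deriv hsExcessFreeEnergy (ρ s x * σ ^ 3)) =
      -(∫ x, ρ s x * (3 / 2 * Real.log (θ s x) - Real.log (ρ s x) - hsExcessFreeEnergy (ρ s x * σ ^ 3))) -
        (3 / 2 * Real.log (2 * Real.pi) + 3 / 2) * ∫ x, ρ s x := by
    intro s hs
    have hsT : s ∈ Ico 0 T := ⟨hs.1, hs.2.trans_lt htT⟩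
    have hρc := (hE.smooth_density.isSmooth_slice hsT).continuous
    have hθc := (hE.smooth_temperature.isSmooth_slice hsT).continuous
    have hρp := hE.density_pos s hsT
    have hθp := hE.temperature_pos s hsT
    have hbs : ∀ x, ρ s x * σ ^ 3 ∈ Ioo 0 ηE := fun x =>
      ⟨mul_pos (hρp x) hσ3, (hg s hs x).trans_le hη₀E⟩
    have hηc : Continuous fun x => ρ s x * σ ^ 3 := hρc.mul continuous_const
    have hfc : Continuous fun x => hsExcessFreeEnergy (ρ s x * σ ^ 3) :=
      hfex.continuousOn.comp_continuous hηc hbs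
    have hf'c : Continuous fun x => deriv hsExcessFreeEnergy (ρ s x * σ ^ 3) :=
      (hfex.continuousOn_deriv_of_isOpen isOpen_Ioo (by simp)).comp_continuous hηc hbs
    have hlogρ : Continuous fun x => Real.log (ρ s x) := hρc.log fun x => (hρp x).ne'
    have hlogθ : Continuous fun x => Real.log (θ s x) := hθc.log fun x => (hθp x).ne'
    have hlog2θ : Continuous fun x => Real.log (2 * Real.pi * θ s x) :=
      (continuous_const.mul hθc).log fun x => (mul_pos (mul_pos two_pos Real.pi_pos) (hθp x)).ne'
    have hi1 : Integrable (fun x => ρ s x * (Real.log (ρ s x) + g (ρ s x) -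
        3 / 2 * Real.log (2 * Real.pi * θ s x) - 3 / 2)) := by
      refine integrable_of_continuous_T3 (hρc.mul ?_)
      exact (((hlogρ.add (hfc.add (hηc.mul hf'c))).sub (continuous_const.mul hlog2θ)).sub continuous_const)
    have hi2 : Integrable (fun x => ρ s x * (ρ s x * σ ^ 3 * deriv hsExcessFreeEnergy (ρ s x * σ ^ 3))) :=
      integrable_of_continuous_T3 (hρc.mul (hηc.mul hf'c))
    have hi3 : Integrable (fun x => ρ s x * (3 / 2 * Real.log (θ s x) - Real.log (ρ s x) -
        hsExcessFreeEnergy (ρ s x * σ ^ 3))) :=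
      integrable_of_continuous_T3 (hρc.mul (((continuous_const.mul hlogθ).sub hlogρ).sub hfc))
    have hi4 : Integrable (ρ s) := integrable_of_continuous_T3 hρc
    have hpt : (fun x => ρ s x * (Real.log (ρ s x) + g (ρ s x) - 3 / 2 * Real.log (2 * Real.pi * θ s x) - 3 / 2) -
        ρ s x * (ρ s x * σ ^ 3 * deriv hsExcessFreeEnergy (ρ s x * σ ^ 3))) =
        fun x => -(ρ s x * (3 / 2 * Real.log (θ s x) - Real.log (ρ s x) - hsExcessFreeEnergy (ρ s x * σ ^ 3))) -
          (3 / 2 * Real.log (2 * Real.pi) + 3 / 2) * ρ s x := by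
      funext x
      have hl : Real.log (2 * Real.pi * θ s x) = Real.log (2 * Real.pi) + Real.log (θ s x) :=
        Real.log_mul (mul_pos two_pos Real.pi_pos).ne' (hθp x).ne'
      simp only [hgdef, hl]
      ring
    rw [← integral_sub hi1 hi2, hpt, integral_sub hi3.fun_neg (hi4.const_mul _), integral_neg, integral_const_mul]
  have hid : (∫ x, ρ 0 x * (Real.log (ρ 0 x) + g (ρ 0 x) - 3 / 2 * Real.log (2 * Real.pi * θ 0 x) - 3 / 2)) -
        (∫ x, ρ 0 x * (ρ 0 x * σ ^ 3 * deriv hsExcessFreeEnergy (ρ 0 x * σ ^ 3))) =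
      (∫ x, ρ t x * (Real.log (ρ t x) + g (ρ t x) - 3 / 2 * Real.log (2 * Real.pi * θ t x) - 3 / 2)) -
        ∫ x, ρ t x * (ρ t x * σ ^ 3 * deriv hsExcessFreeEnergy (ρ t x * σ ^ 3)) := by
    rw [hsplit 0 h0t, hsplit t htt, hEnt, hMass]
  ------------------------------------------------------------------
  -- Step 5: assembly
  ------------------------------------------------------------------
  have hpc : Continuous fun x => ρ 0 x * Real.exp (g (ρ 0 x)) := by
    have hbs : ∀ x, ρ 0 x * σ ^ 3 ∈ Ioo 0 ηE := fun x =>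
      ⟨mul_pos (hρ00 x) hσ3, (hg 0 h0t x).trans_le hη₀E⟩
    have hηc : Continuous fun x => ρ 0 x * σ ^ 3 := hρstc.mul continuous_const
    exact hρstc.mul (((hfex.continuousOn.comp_continuous hηc hbs).add (hηc.mul
      ((hfex.continuousOn_deriv_of_isOpen isOpen_Ioo (by simp)).comp_continuous hηc hbs))).rexp)
  have hqc : Continuous fun x => ρ t x * Real.exp (g (ρ t x)) := by
    have hbs : ∀ x, ρ t x * σ ^ 3 ∈ Ioo 0 ηE := fun x =>
      ⟨mul_pos (hρt0 x) hσ3, (hg t htt x).trans_le hη₀E⟩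
    have hηc : Continuous fun x => ρ t x * σ ^ 3 := hρtc.mul continuous_const
    exact hρtc.mul (((hfex.continuousOn.comp_continuous hηc hbs).add (hηc.mul
      ((hfex.continuousOn_deriv_of_isOpen isOpen_Ioo (by simp)).comp_continuous hηc hbs))).rexp)
  have hp0 : ∀ x, 0 < ρ 0 x * Real.exp (g (ρ 0 x)) := fun x => mul_pos (hρ00 x) (Real.exp_pos _)
  have hq0 : ∀ x, 0 < ρ t x * Real.exp (g (ρ t x)) := fun x => mul_pos (hρt0 x) (Real.exp_pos _)
  refine ⟨fun N => particleLaw (Φ N) (canonicalDensity (Torus.geometry (Fin 3)) (ε N) (n N)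
    (localGibbsProfile (fun x => ρ t x * Real.exp (g (ρ t x))) (u t) (θ t))), fun N => ?_, hS2t, ?_⟩
  · -- finiteness of the reference laws
    beta_reduce
    rcases NearConstantShortTimeHLNegative.particleLaw_canonicalDensity_zero_or_prob (Φ N)
      (localGibbsProfile_nonneg (fun x => (hq0 x).le) (fun x => (hθt0 x).le)) with h | h
    · rw [h]; infer_instance
    · infer_instance
  · -- the relative entropy is `o(n_N)`
    have key := tendsto_klDiv_div_of_means Φ hn_top
      (measurable_localGibbsProfile hpc hθ hu) (measurable_localGibbsProfile hqc hθtc hutc)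
      (fun y => mul_pos (hp0 _) (localMaxwellian_pos one_pos (hθ00 _) _ _))
      (fun y => mul_pos (hq0 _) (localMaxwellian_pos one_pos (hθt0 _) _ _))
      (fun N hZN => canonicalPartition_localGibbs_pos_of_ne_zero hpc hθ hu hp0 hθ00 hqc hθtc hutc hq0 hθt0 hZN)
      (fun N => particleLaw (Φ N) (canonicalDensity (Torus.geometry (Fin 3)) (ε N) (n N)
        (localGibbsProfile (fun x => Real.exp c * (ρ 0 x * Real.exp (g (ρ 0 x)))) (u 0) (θ 0))))
      hPeq hP (log_localGibbsProfile_matched g hρ00 hθ00) (log_localGibbsProfile_matched g hρt0 hθt0) t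
      hπ₀ hπt hm₀i hm₀ hS3 hid
    exact key

end Summit.AtomisticToContinuum.HydrodynamicLimit.Theorems.NearConstantShortTimeHL

end
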